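import Literature.MathematicalPhysics.QuantumFieldTheory.Balaban1983to89.B6Ineq243TwoLevelBox
import Literature.MathematicalPhysics.QuantumFieldTheory.Balaban1983to89.B4Lemma22ZeroBoxDerivDual

/-!
# `Balaban1983to89.B6Ineq243AdjTwoLevelBox` — [B6] (2.43) for the THIRD operator of [3] Lemma 2.2, `G′(□)∂^{L^{−j}*}_μ`
(the two-level cube propagator composed with the ADJOINT difference derivative), uniformly in the mesh — the cube-level
input of the third entry `|(G′∇*λ)(x)|` of Proposition 2.2 (2.67) (file 6 of the two-level parametrix; no existing module
is touched; no fact is minted; every input is a kernel-proved theorem of the `B4*` package, consumed BY NAME)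

FRAMING (verbatim cell line):
statement-level skeleton of published theorems with citation tags; proofs where landed; nothing here is a claim about the Yang–Mills mass gap

Source under audit (cell pub-balaban): T. Bałaban, *Propagators and renormalization transformations for lattice gauge
theories. II*, Commun. Math. Phys. **96** (1984) 223–250 [`Balaban1984PropagatorsII`, "B6"], p. 230 [PDF 8] (2.42)–(2.43),
p. 234 [PDF 12] Proposition 2.2 (2.67) (renders `b2b-balaban-ref1/pages/1984-cmp96-propagators-rt-II/…-p008-x2.png`,
`…-p012-x2.png`, read as images this generation); T. Bałaban, *Regularity and decay of lattice Green's functions*,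
Commun. Math. Phys. **89** (1983) 571–597 [`Balaban1983RegularityDecay`, "[3]" of B6], pp. 577–578 Lemma 2.2 (2.17)
(the three operators `G_k(□)`, `D^η_μG_k(□)`, `G_k(□)D^{η*}_μ`) and p. 583 (2.40)–(2.41), as PROVED at `A = 0` for boxes
in `B4Lemma22ZeroBoxDerivDual` (`lemma22_zero_box_Gdstar_roww_coeff`).

## WHAT IS PRINTED (verbatim up to notation)

p. 230: «Properties of the operators G′_j(□), G′_j(□)Q′_j* and C_Λ^{(j)}(□) are described in Lemmas 2.2, 2.4,
Proposition 2.3 [3]. From these and (2.42) we get |(G′(□)λ)(x)|, |(∂^{L^{−j}}_μG′(□)λ)(x)| ≤ O(1)e^{−δ₀dist(x,supp λ)}|λ|.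
(2.43)»; [3] Lemma 2.2 (2.17): «‖G_k(□,Ã)f‖_q, ‖D^η_{Ã,μ}G_k(□,Ã)f‖_q, ‖G_k(□,Ã)D^{η*}_{Ã,μ}f‖_q ≤ c₂‖f‖_p»;
p. 234, Proposition 2.2: «… the operator G′ = Δ′_a^{−1} satisfies the inequalities |(G′λ)(x)|, |(∇G′λ)(x)|,
|(G′∇*λ)(x)|, … ≤ O(1)[(L^jη)², L^jη, L^jη, …]·e^{−½δ₀d(y,y′)}|λ| … (2.67)».

## WHAT THIS FILE CERTIFIES (kernel-checked; `A = 0`; the lineage is USED, not re-proved)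

Setting and dictionary of `B6Ineq243TwoLevelBox` (`ξ = L^{−j} = 1/n`, fine box `X`, `G′(□) = gTwoLevel`,
`G_j(□) = (boxOpR n a_j m² (LM′))⁻¹`, weighted rows `roww_δ(T)(x) = Σ_{x′}|T(x,x′)|e^{δ|x−x′|_∞/n}`).
* §1 **THE KERNEL OF `T∂^{ξ*}_μ`** for a kernel `T` on the box: `dstar n μ T (x, z) = ξ^{−1}(T(x, fwd_μ z) − T(x, z))`,
  `fwd_μ z = z + e_μ` on the bonds `⟨z, z + ξe_μ⟩ ⊂ □` of [3] (1.3) and `fwd_μ z = z` where there is no bond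
  (`B4Lemma22ZeroBoxDerivDual.fwd`); it is ADDITIVE and RIGHT-LINEAR over kernel composition
  (`dstar_mul : dstar(A·B) = A·dstar(B)`), and the PAIRING IDENTITY `dstar_pairing`
  `Σ_x g(x)(dstar T·f)(x) = Σ_z f(z)·ξ^{−1}((Tᵀg)(fwd_μ z) − (Tᵀg)(z))`, i.e. `⟨g, (T∂*_μ)f⟩ = ⟨∂_μ(Tᵀg), f⟩`, certifies
  that `dstar T` IS the kernel of `T∂^{ξ*}_μ` (bond functions `f`: the value on `⟨z, z + ξe_μ⟩`).
* §2 **(2.43) FOR `G′(□)∂^{ξ*}_μ`, UNIFORMLY IN THE MESH** (`ineq243_twoLevel_dstar_roww`): for every window there are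
  `δ′, c′ > 0` with `Σ_z|ξ^{−1}(G′(□; x, fwd_μ z) − G′(□; x, z))|e^{δ′|x−z|_∞/L^j} ≤ c′` for EVERY `j ≥ 1`, box built of
  `L`-blocks, `Λ ⊆ □^{(j)}`, axis `μ` and site `x` — from (2.42) differenced in the bond (column) variable,
  `dstar G′(□) = dstar G_j(□) + a_j²n^{−(d+1)}·(G_j(□)Q_j^*1_ΛC1_ΛQ_j)·dstar G_j(□)` (`dstar_mul`), the weighted bond sums of
  `G_j(□)∂^{ξ*}_μ` ([3] Lemma 2.2 (2.17) third operator, `lemma22_zero_box_Gdstar_roww_coeff`), the weighted rows of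
  `G_j(□)` ([3] (1.10), `thm110_zero_box_roww_coeff`), the decay of `C_Λ^{(j)}(□)` ([3] (1.16), `cov116_box_finset_decay`)
  and the middle-factor/submultiplicativity bookkeeping of `B6Ineq243TwoLevelBox` (`roww_mid_le`, `roww_mul_le`); the
  printed value clause `ineq243_twoLevel_dstar_value`: `|(G′(□)∂^{ξ*}_μf)(x)| ≤ c′e^{−δ′dist(x, supp f)}‖f‖_∞`.

## HONEST SCOPE

`A = 0`; print displays TWO quantities in (2.43) (`G′(□)λ`, `∂G′(□)λ` — `B6Ineq243TwoLevelBox`), while (2.67) lists the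
third operator `G′∇*`; its cube-level estimate is our reading of «From these [Lemma 2.2 of [3], whose (2.17) includes
`G_k(□)D^{η*}_μ`] and (2.42) we get (2.43)» and is labelled so.  Constants are existential functions of `d`, `ℓ` and
the window; boxes anchored at the origin with sides multiples of `L`; `Λ` arbitrary (the block-union structure is not
needed for the estimate).  Nothing is inferred from the manuscript: every step is kernel-checked.
-/

namespace Literature.MathematicalPhysics.QuantumFieldTheory.Balaban1983to89.B6Ineq243AdjTwoLevelBox

open Finset Matrix
open Literature.MathematicalPhysics.QuantumFieldTheory.Balaban1983to89.B4ContourShift (supNorm supNorm_nonneg)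
open Literature.MathematicalPhysics.QuantumFieldTheory.Balaban1983to89.B4Reflection242 (boxDom mem_boxDom)
open Literature.MathematicalPhysics.QuantumFieldTheory.Balaban1983to89.B4BoxCov237 (boxOpR cov116_box_finset_decay)
open Literature.MathematicalPhysics.QuantumFieldTheory.Balaban1983to89.B4Thm110ZeroBox (roww roww_nonneg roww_add_le
  roww_smul mulVec_le_of_roww thm110_zero_box_roww_coeff)
open Literature.MathematicalPhysics.QuantumFieldTheory.Balaban1983to89.B4Lemma22ZeroBoxDerivDual (fwd fwd_spec
  lemma22_zero_box_Gdstar_roww_coeff)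
open Literature.MathematicalPhysics.QuantumFieldTheory.Balaban1983to89.B6Ineq243TwoLevelBox
open B4Sect5Proof (latticeConst latticeConst_nonneg)

noncomputable section

variable {d : ℕ}

/-! ## §1 The kernel of `T∂^{ξ*}_μ` -/

section Dstar

variable {N : Fin (d + 1) → ℕ}

/-- **THE KERNEL OF `T∂^{ξ*}_μ`**: `(x, z) ↦ ξ^{−1}(T(x, fwd_μ z) − T(x, z))` — the kernel `T` differenced in its COLUMN
variable along the bond `⟨z, z + ξe_μ⟩` (zero where the box has no such bond).  For `T = G_k(□)` this is the kernel of the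
third operator `G_k(□)D^{η*}_μ` of [3] Lemma 2.2 (2.17) (`B4Lemma22ZeroBoxDerivDual`, dictionary `Gdstar_pairing`).
[cite: Balaban1983RegularityDecay, pp. 577–578 Lemma 2.2 (2.17), p. 583 (2.40), dictionary] -/
def dstar (n : ℕ) (μ : Fin (d + 1)) (T : Matrix ↥(boxDom N) ↥(boxDom N) ℝ) : Matrix ↥(boxDom N) ↥(boxDom N) ℝ :=
  Matrix.of fun x z => (n : ℝ) * (T x (fwd N μ z) - T x z)

/-- entries of `dstar`. [cite: Balaban1983RegularityDecay, p. 583 (2.40), dictionary] -/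
theorem dstar_apply (n : ℕ) (μ : Fin (d + 1)) (T : Matrix ↥(boxDom N) ↥(boxDom N) ℝ) (x z : ↥(boxDom N)) :
    dstar n μ T x z = (n : ℝ) * (T x (fwd N μ z) - T x z) := rfl

/-- `dstar` is additive. [cite: Balaban1983RegularityDecay, p. 583 (2.40), dictionary] -/
theorem dstar_add (n : ℕ) (μ : Fin (d + 1)) (A B : Matrix ↥(boxDom N) ↥(boxDom N) ℝ) :
    dstar n μ (A + B) = dstar n μ A + dstar n μ B := by
  ext x z
  simp only [dstar_apply, Matrix.add_apply]
  ring

/-- `dstar` commutes with scalars. [cite: Balaban1983RegularityDecay, p. 583 (2.40), dictionary] -/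
theorem dstar_smul (n : ℕ) (μ : Fin (d + 1)) (c : ℝ) (A : Matrix ↥(boxDom N) ↥(boxDom N) ℝ) :
    dstar n μ (c • A) = c • dstar n μ A := by
  ext x z
  simp only [dstar_apply, Matrix.smul_apply, smul_eq_mul]
  ring

/-- `dstar` of a negated kernel. [cite: Balaban1983RegularityDecay, p. 583 (2.40), dictionary] -/
theorem dstar_neg (n : ℕ) (μ : Fin (d + 1)) (A : Matrix ↥(boxDom N) ↥(boxDom N) ℝ) :
    dstar n μ (-A) = -dstar n μ A := by
  ext x z
  simp only [dstar_apply, Matrix.neg_apply]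
  ring

/-- **RIGHT-LINEARITY OVER COMPOSITION**: `dstar(A·B) = A·dstar(B)` (differencing the column variable of a product
differences the right factor) — the mechanism of (2.40): `G_k(□)∂^* = C^{(0)}∂^* + Σ a_j²…G_jQ_j^*C^{(j)}Q_j(G_j∂^*)`.
[cite: Balaban1983RegularityDecay, p. 583 (2.40)] -/
theorem dstar_mul (n : ℕ) (μ : Fin (d + 1)) (A B : Matrix ↥(boxDom N) ↥(boxDom N) ℝ) :
    dstar n μ (A * B) = A * dstar n μ B := by
  ext x z
  simp only [dstar_apply, Matrix.mul_apply]
  rw [← Finset.sum_sub_distrib, Finset.mul_sum]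
  refine Finset.sum_congr rfl fun w _ => ?_
  ring

/-- `dstar` of a finite sum of kernels. [cite: Balaban1983RegularityDecay, p. 583 (2.40), dictionary] -/
theorem dstar_sum {ι : Type*} (s : Finset ι) (n : ℕ) (μ : Fin (d + 1))
    (A : ι → Matrix ↥(boxDom N) ↥(boxDom N) ℝ) : dstar n μ (∑ i ∈ s, A i) = ∑ i ∈ s, dstar n μ (A i) := by
  classical
  induction s using Finset.induction_on with
  | empty =>
      simp only [Finset.sum_empty]
      ext x z
      simp [dstar_apply]
  | insert i s hi ih => rw [Finset.sum_insert hi, Finset.sum_insert hi, dstar_add, ih]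

/-- the action of `dstar T` on a (bond) function: `(dstar T·f)(x) = Σ_z ξ^{−1}(T(x, fwd_μ z) − T(x, z))f(z)`.
[cite: Balaban1983RegularityDecay, p. 583 (2.40), dictionary] -/
theorem dstar_mulVec (n : ℕ) (μ : Fin (d + 1)) (T : Matrix ↥(boxDom N) ↥(boxDom N) ℝ) (f : ↥(boxDom N) → ℝ)
    (x : ↥(boxDom N)) : (dstar n μ T *ᵥ f) x = ∑ z, (n : ℝ) * (T x (fwd N μ z) - T x z) * f z := rfl

/-- **THE PAIRING IDENTITY** `⟨g, (dstar T)f⟩ = ⟨∂_μ(Tᵀg), f⟩` (`(∂_μφ)(z) = ξ^{−1}(φ(fwd_μ z) − φ(z))`): `dstar T` is the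
kernel of `T∂^{ξ*}_μ`, the adjoint difference derivative composed on the right (the `ξ^{d+1}` weights of the pairings of
site and bond functions cancel).  For symmetric `T` this is `B4Lemma22ZeroBoxDerivDual.Gdstar_pairing`.
[cite: Balaban1983RegularityDecay, p. 572 (1.3), p. 583 («by duality argument»), dictionary] -/
theorem dstar_pairing (n : ℕ) (μ : Fin (d + 1)) (T : Matrix ↥(boxDom N) ↥(boxDom N) ℝ) (f g : ↥(boxDom N) → ℝ) :
    ∑ x, g x * (dstar n μ T *ᵥ f) x = ∑ z, f z * ((n : ℝ) * ((Tᵀ *ᵥ g) (fwd N μ z) - (Tᵀ *ᵥ g) z)) := by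
  have hmv : ∀ w : ↥(boxDom N), (Tᵀ *ᵥ g) w = ∑ x, T x w * g x := fun w => by
    simp only [Matrix.mulVec, dotProduct, Matrix.transpose_apply]
  simp_rw [dstar_mulVec, hmv, Finset.mul_sum]
  rw [Finset.sum_comm]
  refine Finset.sum_congr rfl fun z _ => ?_
  rw [← Finset.sum_sub_distrib, Finset.mul_sum, Finset.mul_sum]
  refine Finset.sum_congr rfl fun x _ => ?_
  ring

/-- the weighted row of `dstar T` at `x` is the weighted bond sum `Σ_z|ξ^{−1}(T(x, fwd_μ z) − T(x, z))|e^{δ|x−z|_∞/n}` of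
[3] (2.41) (the form of `B4Lemma22ZeroBoxDerivDual.lemma22_zero_box_Gdstar_roww`). [cite: Balaban1983RegularityDecay, p. 583 (2.41), dictionary] -/
theorem roww_dstar (δ : ℝ) (n : ℕ) (μ : Fin (d + 1)) (T : Matrix ↥(boxDom N) ↥(boxDom N) ℝ) (x : ↥(boxDom N)) :
    roww δ n (dstar n μ T) x = ∑ z, |(n : ℝ) * (T x (fwd N μ z) - T x z)| * Real.exp (δ * supNorm (x.1 - z.1) / n) :=
  rfl

end Dstar

/-! ## §2 (2.43) for `G′(□)∂^{ξ*}_μ`, uniformly in the mesh `L^{−j}` -/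

/-- **THE DETERMINISTIC ASSEMBLY, ADJOINT DERIVATIVE**: a weighted row bound `c₀` for `G_j(□)` (rate `δ₀`), a weighted
bond-sum bound `c₁` for `G_j(□)∂^{ξ*}_μ` at every site (rate `δ₁`) and the entry decay of `C_Λ^{(j)}(□)` (rate `δ`,
constant `c`) give, for `0 ≤ δ′ ≤ min(δ₀, δ₁, δ/2)`,
`roww_{δ′}(dstar G′(□))(x) ≤ c₁ + a_j²·c₀(ce^{δ′}K_{d+1}(δ/2))c₁` — (2.42) differenced in the bond variable:
`dstar G′(□) = dstar G_j + a_j²n^{−(d+1)}(G_jQ_j^*1_ΛC1_ΛQ_j)·dstar G_j`.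
[cite: Balaban1984PropagatorsII, (2.42)–(2.43) p.230; Balaban1983RegularityDecay, p. 583 (2.40)] -/
theorem gTwoLevel_dstar_roww_le {n ℓ : ℕ} (hn : 1 ≤ n) (aj a m2 : ℝ) {M' : Fin (d + 1) → ℕ}
    (Λ : Finset ↥(boxDom (fun i => (ℓ + 1) * M' i))) {δ₀ c₀ δ₁ c₁ δ c δ' : ℝ}
    (hc₁ : 0 ≤ c₁) (hc : 0 ≤ c) (hδ : 0 < δ) (hδ'0 : 0 ≤ δ') (hδ'1 : δ' ≤ δ₀) (hδ'3 : δ' ≤ δ₁)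
    (hδ'2 : δ' ≤ δ / 2)
    (hG : ∀ z, roww δ₀ n (boxOpR n aj m2 (fun i => (ℓ + 1) * M' i))⁻¹ z ≤ c₀)
    (hC : ∀ y y' : ↥Λ, |cΛ n ℓ aj a m2 M' Λ y y'| ≤ c * Real.exp (-(δ * supNorm (y.1.1 - y'.1.1))))
    (μ : Fin (d + 1))
    (hD : ∀ z, roww δ₁ n (dstar n μ (boxOpR n aj m2 (fun i => (ℓ + 1) * M' i))⁻¹) z ≤ c₁)
    (x : ↥(boxDom (fun i => n * ((ℓ + 1) * M' i)))) :
    roww δ' n (dstar n μ (gTwoLevel n ℓ aj a m2 M' Λ)) x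
      ≤ c₁ + aj ^ 2 * (c₀ * (c * Real.exp δ' * latticeConst (d + 1) (δ / 2)) * c₁) := by
  have hn' : (0 : ℝ) < n := by exact_mod_cast hn
  have hnD : (0 : ℝ) < ((n : ℝ)) ^ (d + 1) := by positivity
  set G := (boxOpR n aj m2 (fun i => (ℓ + 1) * M' i))⁻¹ with hGdef
  have hGrow : ∀ z, roww δ' n G z ≤ c₀ := fun z => (roww_mono hδ'1 n _ z).trans (hG z)
  have hDrow : ∀ z, roww δ' n (dstar n μ G) z ≤ c₁ := fun z => (roww_mono hδ'3 n _ z).trans (hD z)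
  have hmid : ∀ z, roww δ' n ((indBΛ n Λ)ᵀ * cΛ n ℓ aj a m2 M' Λ * indBΛ n Λ) z
      ≤ c * Real.exp δ' * (((n : ℝ)) ^ (d + 1) * latticeConst (d + 1) (δ / 2)) :=
    fun z => roww_mid_le hn Λ hc hδ hδ'0 hδ'2 hC z
  have hK0 : 0 ≤ c * Real.exp δ' * (((n : ℝ)) ^ (d + 1) * latticeConst (d + 1) (δ / 2)) := by
    have := latticeConst_nonneg (d + 1) (half_pos hδ).le
    positivity
  -- (2.42) differenced in the bond variable
  have hsplit : dstar n μ (gTwoLevel n ℓ aj a m2 M' Λ)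
      = dstar n μ G + (aj ^ 2 * (((n : ℝ)) ^ (d + 1))⁻¹) •
          (G * ((indBΛ n Λ)ᵀ * cΛ n ℓ aj a m2 M' Λ * indBΛ n Λ) * dstar n μ G) := by
    unfold gTwoLevel
    rw [dstar_add, dstar_smul, ← hGdef, show G * (indBΛ n Λ)ᵀ * cΛ n ℓ aj a m2 M' Λ * indBΛ n Λ * G
        = (G * ((indBΛ n Λ)ᵀ * cΛ n ℓ aj a m2 M' Λ * indBΛ n Λ)) * G by simp only [Matrix.mul_assoc], dstar_mul]
  have h3 : roww δ' n (G * ((indBΛ n Λ)ᵀ * cΛ n ℓ aj a m2 M' Λ * indBΛ n Λ) * dstar n μ G) x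
      ≤ c₀ * (c * Real.exp δ' * (((n : ℝ)) ^ (d + 1) * latticeConst (d + 1) (δ / 2))) * c₁ := by
    calc roww δ' n (G * ((indBΛ n Λ)ᵀ * cΛ n ℓ aj a m2 M' Λ * indBΛ n Λ) * dstar n μ G) x
        ≤ roww δ' n (G * ((indBΛ n Λ)ᵀ * cΛ n ℓ aj a m2 M' Λ * indBΛ n Λ)) x * c₁ :=
          roww_mul_le hδ'0 n _ _ hDrow x
      _ ≤ roww δ' n G x * (c * Real.exp δ' * (((n : ℝ)) ^ (d + 1) * latticeConst (d + 1) (δ / 2))) * c₁ :=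
          mul_le_mul_of_nonneg_right (roww_mul_le hδ'0 n _ _ hmid x) hc₁
      _ ≤ c₀ * (c * Real.exp δ' * (((n : ℝ)) ^ (d + 1) * latticeConst (d + 1) (δ / 2))) * c₁ :=
          mul_le_mul_of_nonneg_right (mul_le_mul_of_nonneg_right (hGrow x) hK0) hc₁
  rw [hsplit]
  calc roww δ' n (dstar n μ G + (aj ^ 2 * (((n : ℝ)) ^ (d + 1))⁻¹) •
          (G * ((indBΛ n Λ)ᵀ * cΛ n ℓ aj a m2 M' Λ * indBΛ n Λ) * dstar n μ G)) x
      ≤ roww δ' n (dstar n μ G) x + roww δ' n ((aj ^ 2 * (((n : ℝ)) ^ (d + 1))⁻¹) •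
          (G * ((indBΛ n Λ)ᵀ * cΛ n ℓ aj a m2 M' Λ * indBΛ n Λ) * dstar n μ G)) x := roww_add_le _ _ _ _ _
    _ ≤ c₁ + (aj ^ 2 * (((n : ℝ)) ^ (d + 1))⁻¹)
          * (c₀ * (c * Real.exp δ' * (((n : ℝ)) ^ (d + 1) * latticeConst (d + 1) (δ / 2))) * c₁) := by
        rw [roww_smul _ _ (by positivity)]
        exact add_le_add (hDrow x) (mul_le_mul_of_nonneg_left h3 (by positivity))
    _ = c₁ + aj ^ 2 * (c₀ * (c * Real.exp δ' * latticeConst (d + 1) (δ / 2)) * c₁) := by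
        field_simp

/-- **[B6] (2.43) FOR THE THIRD OPERATOR `G′(□)∂^{L^{−j}*}_μ` OF [3] LEMMA 2.2, GENUINE TWO-LEVEL CUBE PROPAGATOR,
UNIFORMLY IN THE MESH — weighted form.**  For every dimension `d + 1`, block size `L = ℓ + 1 ≥ 2` and window
(`a_j ∈ [a₋, a₊]`, `m² ∈ [0, m²₊]`, `a ∈ [a₂₋, a₂₊]`, `a₋, a₂₋ > 0`) there are `δ′, c′ > 0` such that for EVERY `j ≥ 1`
(`n = L^j`), every point of the window, EVERY box `□` built of `L`-blocks, EVERY `Λ ⊆ □^{(j)}`, every axis `μ` and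
every site `x`: `Σ_{z ∈ □} |ξ^{−1}(G′(□; x, fwd_μ z) − G′(□; x, z))|·e^{δ′|x − z|_∞/L^j} ≤ c′` (`ξ = L^{−j}`; the sum runs
over the bonds `⟨z, z + ξe_μ⟩ ⊂ □`, sites without a forward bond contributing `0`).  Inputs BY NAME:
`B4Lemma22ZeroBoxDerivDual.lemma22_zero_box_Gdstar_roww_coeff` ([3] Lemma 2.2 (2.17) for `G_k(□)D^{η*}_μ` at `A = 0`),
`B4Thm110ZeroBox.thm110_zero_box_roww_coeff`, `B4BoxCov237.cov116_box_finset_decay` — «From these and (2.42) we get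
(2.43)».  HONEST SCOPE: `A = 0`; print displays (2.43) for `G′(□)` and `∂G′(□)` only — this is the same corollary of
(2.42) for the third operator of [3] Lemma 2.2, which (2.67) uses; constants depend on `d`, `ℓ`, the window.
[cite: Balaban1984PropagatorsII, (2.43) p.230 with Proposition 2.2 (2.67) p.234; Balaban1983RegularityDecay, Lemma 2.2 (2.17) pp.577–578] -/
theorem ineq243_twoLevel_dstar_roww (d ℓ : ℕ) (hℓ : 1 ≤ ℓ) (aminus aplus m2plus a2minus a2plus : ℝ)
    (ha : 0 < aminus) (ha2 : 0 < a2minus) :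
    ∃ δ' c' : ℝ, 0 < δ' ∧ 0 < c' ∧ ∀ (k : ℕ), 1 ≤ k → ∀ (aj m2 a : ℝ), aminus ≤ aj → aj ≤ aplus → 0 ≤ m2 →
      m2 ≤ m2plus → a2minus ≤ a → a ≤ a2plus → ∀ (M' : Fin (d + 1) → ℕ), (∀ i, 1 ≤ M' i) →
        ∀ (Λ : Finset ↥(boxDom (fun i => (ℓ + 1) * M' i))) (μ : Fin (d + 1))
          (x : ↥(boxDom (fun i => (ℓ + 1) ^ k * ((ℓ + 1) * M' i)))),
          roww δ' ((ℓ + 1) ^ k) (dstar ((ℓ + 1) ^ k) μ (gTwoLevel ((ℓ + 1) ^ k) ℓ aj a m2 M' Λ)) x ≤ c' := by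
  obtain ⟨δ₀, c₀, hδ₀, hc₀, hG⟩ := thm110_zero_box_roww_coeff d ℓ hℓ aminus aplus m2plus ha
  obtain ⟨δ₁, c₁, hδ₁, hc₁, hGD⟩ := lemma22_zero_box_Gdstar_roww_coeff d ℓ hℓ aminus aplus m2plus ha
  obtain ⟨δ, c, hδ, hc, hC⟩ := cov116_box_finset_decay d ℓ hℓ aminus aplus m2plus a2minus a2plus ha ha2
  have hδ'pos : 0 < min (min δ₀ δ₁) (δ / 2) := lt_min (lt_min hδ₀ hδ₁) (half_pos hδ)
  have hKn : 0 ≤ latticeConst (d + 1) (δ / 2) := latticeConst_nonneg (d + 1) (half_pos hδ).le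
  refine ⟨min (min δ₀ δ₁) (δ / 2),
    c₁ + aplus ^ 2 * (c₀ * (c * Real.exp (min (min δ₀ δ₁) (δ / 2)) * latticeConst (d + 1) (δ / 2)) * c₁),
    hδ'pos, by positivity, ?_⟩
  intro k hk aj m2 a h1 h2 h3 h4 h5 h6 M' hM Λ μ x
  have hn1 : 1 ≤ (ℓ + 1) ^ k := Nat.one_le_pow _ _ (by omega)
  have hMℓ : ∀ i, 1 ≤ (ℓ + 1) * M' i := fun i => by nlinarith [hM i]
  have haj : 0 < aj := lt_of_lt_of_le ha h1
  have hGz : ∀ z, roww δ₀ ((ℓ + 1) ^ k) (boxOpR ((ℓ + 1) ^ k) aj m2 (fun i => (ℓ + 1) * M' i))⁻¹ z ≤ c₀ :=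
    fun z => hG k hk aj m2 h1 h2 h3 h4 (fun i => (ℓ + 1) * M' i) hMℓ z
  have hGDz : ∀ z, roww δ₁ ((ℓ + 1) ^ k)
      (dstar ((ℓ + 1) ^ k) μ (boxOpR ((ℓ + 1) ^ k) aj m2 (fun i => (ℓ + 1) * M' i))⁻¹) z ≤ c₁ := by
    intro z
    rw [roww_dstar]
    exact hGD k hk aj m2 h1 h2 h3 h4 (fun i => (ℓ + 1) * M' i) hMℓ μ z
  have hCz := (hC ((ℓ + 1) ^ k) hn1 aj m2 a h1 h2 h3 h4 h5 h6 M' hM Λ).2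
  have hmain := gTwoLevel_dstar_roww_le hn1 aj a m2 Λ hc₁.le hc.le hδ hδ'pos.le
    ((min_le_left _ _).trans (min_le_left _ _)) ((min_le_left _ _).trans (min_le_right _ _))
    (min_le_right _ _) hGz hCz μ hGDz x
  refine hmain.trans ?_
  have : aj ^ 2 ≤ aplus ^ 2 := pow_le_pow_left₀ haj.le h2 2
  have h0 : 0 ≤ c₀ * (c * Real.exp (min (min δ₀ δ₁) (δ / 2)) * latticeConst (d + 1) (δ / 2)) * c₁ := by
    positivity
  nlinarith

/-- **[B6] (2.43), THIRD OPERATOR — THE PRINTED VALUE CLAUSE** `|(G′(□)∂^{L^{−j}*}_μf)(x)| ≤ O(1)e^{−δ₀dist(x, supp f)}|f|`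
for the genuine two-level cube propagator, uniformly in the mesh: for every bond function `f` (`f(z)` = the value on
`⟨z, z + ξe_μ⟩`), every `F ≥ |f|` and every `D ≤ |x − z|_∞` on `supp f` (fine units):
`|Σ_z ξ^{−1}(G′(□; x, fwd_μ z) − G′(□; x, z))f(z)| ≤ c′e^{−δ′D/L^j}F`.
[cite: Balaban1984PropagatorsII, (2.43) p.230 with Proposition 2.2 (2.67) p.234; Balaban1983RegularityDecay, Lemma 2.2 (2.17) pp.577–578] -/
theorem ineq243_twoLevel_dstar_value (d ℓ : ℕ) (hℓ : 1 ≤ ℓ) (aminus aplus m2plus a2minus a2plus : ℝ)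
    (ha : 0 < aminus) (ha2 : 0 < a2minus) :
    ∃ δ' c' : ℝ, 0 < δ' ∧ 0 < c' ∧ ∀ (k : ℕ), 1 ≤ k → ∀ (aj m2 a : ℝ), aminus ≤ aj → aj ≤ aplus → 0 ≤ m2 →
      m2 ≤ m2plus → a2minus ≤ a → a ≤ a2plus → ∀ (M' : Fin (d + 1) → ℕ), (∀ i, 1 ≤ M' i) →
        ∀ (Λ : Finset ↥(boxDom (fun i => (ℓ + 1) * M' i))) (μ : Fin (d + 1))
          (f : ↥(boxDom (fun i => (ℓ + 1) ^ k * ((ℓ + 1) * M' i))) → ℝ) (F D : ℝ), (∀ z, |f z| ≤ F) →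
          ∀ x : ↥(boxDom (fun i => (ℓ + 1) ^ k * ((ℓ + 1) * M' i))),
            (∀ z, f z ≠ 0 → D ≤ supNorm (x.1 - z.1)) →
              |(dstar ((ℓ + 1) ^ k) μ (gTwoLevel ((ℓ + 1) ^ k) ℓ aj a m2 M' Λ) *ᵥ f) x|
                ≤ c' * Real.exp (-(δ' * D / (((ℓ + 1) ^ k : ℕ) : ℝ))) * F := by
  obtain ⟨δ', c', hδ', hc', h⟩ := ineq243_twoLevel_dstar_roww d ℓ hℓ aminus aplus m2plus a2minus a2plus ha ha2
  refine ⟨δ', c', hδ', hc', ?_⟩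
  intro k hk aj m2 a h1 h2 h3 h4 h5 h6 M' hM Λ μ f F D hF x hD
  exact mulVec_le_of_roww hδ'.le _ _ x (h k hk aj m2 a h1 h2 h3 h4 h5 h6 M' hM Λ μ x) f hF hD

/-- **DICTIONARY CHECK** for the genuine two-level cube propagator (symmetric, `gTwoLevel_isSymm`): the operator bounded
above is the adjoint one — `⟨g, (dstar G′(□))f⟩ = ⟨∂^{ξ}_μ(G′(□)g), f⟩`.
[cite: Balaban1983RegularityDecay, p. 583 («by duality argument»), dictionary] -/
theorem gTwoLevel_dstar_pairing (n ℓ : ℕ) (aj a m2 : ℝ) (M' : Fin (d + 1) → ℕ)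
    (Λ : Finset ↥(boxDom (fun i => (ℓ + 1) * M' i))) (μ : Fin (d + 1))
    (f g : ↥(boxDom (fun i => n * ((ℓ + 1) * M' i))) → ℝ) :
    ∑ x, g x * (dstar n μ (gTwoLevel n ℓ aj a m2 M' Λ) *ᵥ f) x
      = ∑ z, f z * ((n : ℝ) * ((gTwoLevel n ℓ aj a m2 M' Λ *ᵥ g) (fwd _ μ z)
          - (gTwoLevel n ℓ aj a m2 M' Λ *ᵥ g) z)) := by
  rw [dstar_pairing, (gTwoLevel_isSymm n ℓ aj a m2 M' Λ).eq]

/-! ## §3 Non-vacuity (`d + 1 = 4`, `L = 2`, windows `a_j ∈ [1/2, 2]`, `m² ∈ [0, 1]`, `a ∈ [1/2, 2]`) -/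

/-- the main estimate at the physical dimension `d + 1 = 4`, `L = 2`. -/
example : ∃ δ' c' : ℝ, 0 < δ' ∧ 0 < c' ∧ ∀ (k : ℕ), 1 ≤ k → ∀ (aj m2 a : ℝ), (1 / 2 : ℝ) ≤ aj → aj ≤ 2 →
    0 ≤ m2 → m2 ≤ 1 → (1 / 2 : ℝ) ≤ a → a ≤ 2 → ∀ (M' : Fin (3 + 1) → ℕ), (∀ i, 1 ≤ M' i) →
      ∀ (Λ : Finset ↥(boxDom (fun i => (1 + 1) * M' i))) (μ : Fin (3 + 1))
        (x : ↥(boxDom (fun i => (1 + 1) ^ k * ((1 + 1) * M' i)))),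
        roww δ' ((1 + 1) ^ k) (dstar ((1 + 1) ^ k) μ (gTwoLevel ((1 + 1) ^ k) 1 aj a m2 M' Λ)) x ≤ c' :=
  ineq243_twoLevel_dstar_roww 3 1 le_rfl (1 / 2) 2 1 (1 / 2) 2 (by norm_num) (by norm_num)

/-- the quantifier prefix is inhabited: `k = 1`, the point `a_j = a = 1`, `m² = 0` of the window, the unit cube of
`L`-blocks `M′ ≡ 1`, `Λ = ∅`, axis `0` and the site `0` of the fine box. -/
example : (1 : ℕ) ≤ 1 ∧ (1 / 2 : ℝ) ≤ 1 ∧ (1 : ℝ) ≤ 2 ∧ (0 : ℝ) ≤ 0 ∧ (0 : ℝ) ≤ 1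
    ∧ (∀ i : Fin (3 + 1), 1 ≤ (fun _ => 1 : Fin (3 + 1) → ℕ) i)
    ∧ (fun _ => (0 : ℤ)) ∈ boxDom (fun i : Fin (3 + 1) => (1 + 1) ^ 1 * ((1 + 1) * (fun _ => 1 : Fin (3 + 1) → ℕ) i)) := by
  refine ⟨le_rfl, by norm_num, by norm_num, le_rfl, by norm_num, fun _ => le_rfl, ?_⟩
  exact mem_boxDom.2 fun _ => ⟨le_rfl, by norm_num⟩

end

end Literature.MathematicalPhysics.QuantumFieldTheory.Balaban1983to89.B6Ineq243AdjTwoLevelBox
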